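import Summits.ValiantsHypothesis.ValiantsHypothesis.Theorems.LacunarySymmetroidMatrixDescartesDoorA26WallBubblingMixThree
import Summits.ValiantsHypothesis.ValiantsHypothesis.Theorems.LacunarySymmetroidMatrixDescartesDoorA26WallBubblingTwoPairChainSym
import Summits.ValiantsHypothesis.ValiantsHypothesis.Theorems.LacunarySymmetroidMatrixDescartesDoorA26WallBubblingWallStratumReduction
import Summits.ValiantsHypothesis.ValiantsHypothesis.Theorems.LacunarySymmetroidMatrixDescartesDoorA26WallBubblingDoublyConfluentNondegWallC1
import Summits.ValiantsHypothesis.ValiantsHypothesis.Theorems.LacunarySymmetroidMatrixDescartesDoorA26WallBubblingDoublyConfluentNondegWallC2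

/-!
# Wall bubbling for `DoorA26` — THE WALL STRATUM `Stmt.weylFaces_wall` IS CLOSED IN THE KERNEL (no accumulation of twenties, door-free)

HONEST FRAMING.  Obligation (W) `stub_weylFaces` of `Cruxes/DoorA26/Lines/wall_bubbling.lean` (crux `DoorA26`, stmt-ValiantsHypothesis-19979; OPEN,
typed, never asserted) splits (statement file `Cruxes/DoorA26/Lines/wall_bubbling_ConfluentDoor.lean`, rev 5d ff.) into the Weyl-generic faces
(modulo the doors `ConfluentDoor26` / `NoTightChain26NC`), (M), (W_deepVal) and the WALL STRATUM
`Stmt.weylFaces_wall := ∀ δ ∈ SortedSimplex, HasWeylCoincidence δ → ¬ HasMixedCoincidence δ → ¬ IsValueGeneric δ → δ ∉ closure TwentyLocus`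
(a Weyl coincidence meeting a disjoint-type value coincidence, no mixed one).  W1 seat val-sym-door-p2 g14 (#62).  THIS FILE PROVES (W_wall)
OUTRIGHT — NO door, NO open hypothesis:

* **`weylFaces_wall_closed : ‹Stmt.weylFaces_wall with the rev-5d predicates inlined verbatim›`** (the Theorems-side copies of `SortedSimplex`,
  `TwentyLocus`; the statement is byte-identical to the conclusion of W1 #43 `weylFaces_wall_of_twoPairChains`), so the line file links
  `Stmt.weylFaces_wall_holds : Stmt.weylFaces_wall := fun δ hδ hW hM hV => weylFaces_wall_closed δ hδ hW hM hV`.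

Assembly (all kernel, all in the tree): W1 #43 `weylFaces_wall_of_twoPairChains` (one-pair walls by W1 #42; relabelling to the two two-pair walls
(c1)/(c2)) ∘ W1 #61 `twoPair_noTwenties_of_mixedRules'` (the two-pair tight chain over the doubly-confluent clusters, W1 #45–#52d) fed with the
THREE MIXED-CLASS RULES NOW PROVED — W1 #54 `mixTop_face`, #55 `mixMid_face`, #60 `mixThree_face'` (symmetric letters, `δ0 0 ≠ δ0 1`; the unprimed
three-scale rule is false, crit-5 g4) — and the wall non-degeneracies W1 #26d/#26b.  The `hgen` reshuffles are those of rev 8's link.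

What this is NOT: it is not (W) — the Weyl-GENERIC faces still rest on the doors `ConfluentDoor26` ∧ `NoTightChain26NC` (OPEN), (M)
`Stmt.stub_mixedWalls` (14/18 NOT KILLED) and (W_deepVal)'s three strata hypotheses are OPEN; `DoorA26` (19979), 18050 OPEN, typed never asserted;
registers unchanged (ζ_sym(2,6) ∈ {18,19,20}); nothing on VP ≠ VNP.  Def-free.  `--supports stmt-ValiantsHypothesis-19979 --as helper`.
-/

-- `Summit.ValiantsHypothesis.ValiantsHypothesis.…` repeats a component by the D-0017 layout
-- (single-conjunct summit), which the `dupNamespace` linter flags; the name is mandated.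
set_option linter.dupNamespace false

namespace Summit.ValiantsHypothesis.ValiantsHypothesis.Theorems.LacunarySymmetroidMatrixDescartes.WallBubbling

open Finset Filter Topology
open Bubbling (polar TwentyLocus SortedSimplex)
open scoped BigOperators

/-- **(W_wall) CLOSED: at a point of the sorted simplex with a Weyl coincidence, no mixed (three-term) coincidence and some non-trivial value
coincidence, twenties do NOT accumulate** — `Stmt.weylFaces_wall` of the line file with its predicates inlined (byte-identical to the conclusion of
W1 #43).  Door-free, hypothesis-free. [this work] -/
theorem weylFaces_wall_closed :
    ∀ δ ∈ SortedSimplex, (∃ i j : Fin 6, i ≠ j ∧ δ i = δ j) →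
      ¬ (∃ i k l : Fin 6, i ≠ k ∧ i ≠ l ∧ k ≠ l ∧ 2 * δ i = δ k + δ l) →
      ¬ (∀ a b c d : Fin 6, δ a + δ b = δ c + δ d → (δ a = δ c ∧ δ b = δ d) ∨ (δ a = δ d ∧ δ b = δ c)) →
      δ ∉ closure TwentyLocus :=
  weylFaces_wall_of_twoPairChains
    (fun δs δ0 hδ0 h50 h41 hrel hgen U hU hne z hz hroot =>
      twoPair_noTwenties_of_mixedRules' δ0 h50 h41 (mixTop_face δ0 h50 h41) (mixMid_face δ0 h50 h41) (mixThree_face' δ0 h50 h41)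
        (fun a b c e h => (hgen a b c e h).elim Or.inl (fun h2 => h2.elim (fun x => Or.inr (Or.inl x))
          (fun x => Or.inr (Or.inr (Or.inl x)))))
        (fun W hWs hW' => doublyConfluentDet_ne_zero_of_polar_ne_zero_wallC1 δ0 h50 h41 hrel hgen W hWs hW')
        δs hδ0 U hU hne z hz hroot)
    (fun δs δ0 hδ0 h50 h41 hrel hgen U hU hne z hz hroot =>
      twoPair_noTwenties_of_mixedRules' δ0 h50 h41 (mixTop_face δ0 h50 h41) (mixMid_face δ0 h50 h41) (mixThree_face' δ0 h50 h41)
        (fun a b c e h => (hgen a b c e h).elim Or.inl (fun h2 => h2.elim (fun x => Or.inr (Or.inl x))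
          (fun x => Or.inr (Or.inr (Or.inr x)))))
        (fun W hWs hW' => doublyConfluentDet_ne_zero_of_polar_ne_zero_wallC2 δ0 h50 h41 hrel hgen W hWs hW')
        δs hδ0 U hU hne z hz hroot)

end Summit.ValiantsHypothesis.ValiantsHypothesis.Theorems.LacunarySymmetroidMatrixDescartes.WallBubbling
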